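import Summits.BirchSwinnertonDyer.BirchSwinnertonDyer.Theorems.AlignedTransportAtTwoMainConjectureOfRankZeroBSDAtTwoSelmerLayerGrowthDichotomy
import Summits.BirchSwinnertonDyer.BirchSwinnertonDyer.Theorems.AlignedTransportAtTwoMainConjectureOfRankZeroBSDAtTwoSelmerLayerControlLocal
import HarnessLib

/-!
# Route `AlignedTransportAtTwo`, crux C2 `MainConjectureOfRankZeroBSDAtTwo` (stmt-BirchSwinnertonDyer-22298):
# THE FIRST LAYER OVER `ℚ`, EVERY GOOD ORDINARY `p` —
# `corank_{ℤ_p} Sel_{p^∞}(E_{ℚ_1}/ℚ_1) = corank_{ℤ_p} Sel_{p^∞}(E/ℚ) + rank_{ℤ_p} X/ξ_pX` (`ξ_p = Φ_p(1+T)`) MODULO EXACTLY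
# Greenberg's Lemma 3.4 at the layer `n = 1`; UNCONDITIONALLY `≤`; and `ξ_p ∣ char_Λ X` from a first-layer Selmer jump

HONEST FRAMING (cell `bsd-f1-sign2`, WIDTH-5 attached prover seat `bsd-line-att-p5` gen 40 on line `birth` of the lead
`bsd-line-att-p2`; `--supports` stmt-BirchSwinnertonDyer-22298, closes nothing; BSD is NOT proved by any of this; the crux
C2, its verdict «blocked-on `Rank1Residual.GreenbergMuConjectureIrreducible`» and every registered stub are untouched).
THEOREMS ONLY — no `def`, no instance, no NEW named fact, no `sorry`; ONE theorem (`…_of_lemma34`) is CONDITIONAL on the tree's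
existing named print fact `Greenberg1999.lemma34_natCard_localTowerKerPrimary_eq_rat`, displayed as a hypothesis.

The `p`-general twin of `…SelmerLayerTwoSidedMatching` (there `p = 2`, `ξ_2 = T + 2`, and the extra reading
`rank X/(T+2)X ↔ corank Sel(W⁽²⁾/ℚ)` by Dokchitser–Dokchitser): the layer split `…SelmerLayerSplit` at `n = 0`, layer-`0` control over
`ℚ` (`Greenberg1999_coinvariantsRank_eq_selmerCorank_rat_holds`, Lemma 3.4 at `n = 0` PROVED), and control at layer `1` in corank form
(`…SelmerLayerControl`) whose one input is localised to `v = p` (`…SelmerLayerControlLocal`). With `ξ_p = xi p` the tree's first-layer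
polynomial (`Rank1Residual/X1/CyclotomicZeros`; `= Φ_p(1+T) = ∑_{i<p}(1+T)^i`):

* `lambdaInvariant_layerQuotient_zero_eq_coinvariantsRank` (`rank X/ω_0X = rank X/TX`), `lambdaInvariant_cyclotomicFactor_zero_eq_xi`
  (spelling `∑_{i<p}((1+T)^{p⁰})^i ↔ ξ_p`);
* ★★ `selmerCorank_layer_one_le` — **`corank Sel_{p^∞}(E_{ℚ_1}/ℚ_1) ≤ corank Sel_{p^∞}(E/ℚ) + rank_{ℤ_p} X/ξ_pX` UNCONDITIONALLY**;
* ★★★ `selmerCorank_layer_one_eq_add_of_finite_cokerS` / `…_of_finite_kerG` / `…_of_finite_localTowerKerPrimary_one` / `…_of_lemma34` —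
  **EQUALITY as soon as `coker s_1` / `ker g_1` is finite / `𝒦_{v,1}[p^∞]` is finite at `v = p` / granted the named fact Lemma 3.4**;
* ★★ `xi_dvd_of_mem_charIdeal_of_selmerCorank_lt_layer_one` — **`corank Sel_{p^∞}(E/ℚ) < corank Sel_{p^∞}(E_{ℚ_1}/ℚ_1) ⟹ ξ_p ∣ char_Λ X`
  UNCONDITIONALLY** (new points OR new Ш over `ℚ_1` force the first cyclotomic zero; `…SelmerLayerGrowthDichotomy` §3 in the `ξ_p` spelling).

References: R. Greenberg, LNM 1716 (1999), Thm. 1.2, §1 p. 65, §3 Lemmas 3.1–3.5, §5 p. 132 [GreenbergLNM1716]; B. Mazur, Invent.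
Math. 18 (1972), §6 [Mazur1972]; L. Washington, GTM 83, §13.2 [Washington1997].
-/

set_option linter.dupNamespace false
set_option autoImplicit false

noncomputable section

open scoped Classical AddSubgroup TensorProduct Polynomial

universe u

namespace Summit.BirchSwinnertonDyer.BirchSwinnertonDyer.Theorems.AlignedTransportAtTwoSelmerLayerOneMatching

open Polynomial WeierstrassCurve Literature.NumberTheory.EllipticCurves Literature.NumberTheory.EllipticCurves.IwasawaDual
  Summit.BirchSwinnertonDyer.Rank1Residual.X1.CyclotomicZeros
  Summit.BirchSwinnertonDyer.BirchSwinnertonDyer.Theorems.AlignedTransportAtTwoSelmerLayerModel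
  Summit.BirchSwinnertonDyer.BirchSwinnertonDyer.Theorems.AlignedTransportAtTwoSelmerLayerDuality
  Summit.BirchSwinnertonDyer.BirchSwinnertonDyer.Theorems.AlignedTransportAtTwoSelmerLayerControl
  Summit.BirchSwinnertonDyer.BirchSwinnertonDyer.Theorems.AlignedTransportAtTwoSelmerLayerSplit
  Summit.BirchSwinnertonDyer.BirchSwinnertonDyer.Theorems.AlignedTransportAtTwoSelmerLayerControlLocal
  Summit.BirchSwinnertonDyer.BirchSwinnertonDyer.Theorems.AlignedTransportAtTwoSelmerLayerGrowthDichotomy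
  Summit.BirchSwinnertonDyer.BirchSwinnertonDyer.Theorems.AlignedTransportAtTwoCyclotomicLayerPrime

/-! ## §1 Spellings at the first layer -/

section Spelling

variable {K : Type u} [Field K] [NumberField K] (W : WeierstrassCurve K) (p : ℕ) [hp : Fact p.Prime]
  (κ : ZpExtension K p) {γ : Field.absoluteGaloisGroup K}

/-- `rank_{ℤ_p} X/ω_0X = rank_{ℤ_p} X/TX = coinvariantsRank` (`ω_0 = (1+T)^1 − 1 = T`). [folklore] -/
theorem lambdaInvariant_layerQuotient_zero_eq_coinvariantsRank (D : W.SelmerDualData κ γ) :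
    lambdaInvariant p (D.X ⧸ (Ideal.span {((1 + PowerSeries.X : PowerSeries ℤ_[p]) ^ (p ^ 0) - 1 : IwasawaAlgebra p)} •
        ⊤ : Submodule (IwasawaAlgebra p) D.X)) = IwasawaAlgebra.coinvariantsRank p D.X := by
  have e : Ideal.span {((1 + PowerSeries.X : PowerSeries ℤ_[p]) ^ (p ^ 0) - 1 : IwasawaAlgebra p)} •
      (⊤ : Submodule (IwasawaAlgebra p) D.X) = Ideal.span {(PowerSeries.X : IwasawaAlgebra p)} • ⊤ := by
    rw [pow_zero, pow_one, add_sub_cancel_left]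
  rw [lambdaInvariant_eq_of_linearEquiv (Submodule.quotEquivOfEq _ _ e)]
  rfl

/-- `Ψ_1 = ∑_{i<p} ((1+T)^{p⁰})^i = ξ_p` as elements of `Λ` (`coe_cyclotomicLayer_eq_sum`, `coe_cyclotomicLayer_zero`). [folklore] -/
theorem sum_pow_pow_zero_eq_xi :
    (∑ i ∈ Finset.range p, ((1 + PowerSeries.X : PowerSeries ℤ_[p]) ^ (p ^ 0)) ^ i : IwasawaAlgebra p) = xi p := by
  rw [← coe_cyclotomicLayer_eq_sum p 0, coe_cyclotomicLayer_zero]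

/-- `rank_{ℤ_p} X/Ψ_1X = rank_{ℤ_p} X/ξ_pX` (spelling). [folklore] -/
theorem lambdaInvariant_cyclotomicFactor_zero_eq_xi (D : W.SelmerDualData κ γ) :
    lambdaInvariant p (D.X ⧸ (Ideal.span
        {(∑ i ∈ Finset.range p, ((1 + PowerSeries.X : PowerSeries ℤ_[p]) ^ (p ^ 0)) ^ i : IwasawaAlgebra p)} •
          ⊤ : Submodule (IwasawaAlgebra p) D.X)) =
      lambdaInvariant p (D.X ⧸ (Ideal.span {xi p} • ⊤ : Submodule (IwasawaAlgebra p) D.X)) := by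
  have e : Ideal.span {(∑ i ∈ Finset.range p, ((1 + PowerSeries.X : PowerSeries ℤ_[p]) ^ (p ^ 0)) ^ i : IwasawaAlgebra p)} •
      (⊤ : Submodule (IwasawaAlgebra p) D.X) = Ideal.span {xi p} • ⊤ := by
    rw [sum_pow_pow_zero_eq_xi]
  exact lambdaInvariant_eq_of_linearEquiv (Submodule.quotEquivOfEq _ _ e)

end Spelling

/-! ## §2 Over `ℚ`: the first layer -/

section RatLayerOne

variable (W : WeierstrassCurve ℚ) [W.IsElliptic] [W.IsGloballyMinimal] {p : ℕ} [hp : Fact p.Prime]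
  {κ : ZpExtension ℚ p} {γ : Field.absoluteGaloisGroup ℚ}

/-- ★★ **`corank_{ℤ_p} Sel_{p^∞}(E_{ℚ_1}/ℚ_1) ≤ corank_{ℤ_p} Sel_{p^∞}(E/ℚ) + rank_{ℤ_p} X/ξ_pX`, UNCONDITIONALLY** (`W/ℚ` globally minimal,
good ordinary at `p`, `κ` cyclotomic with topological generator `γ`, any dual datum): Lemma 3.1 at layer `1`, the layer split at
`n = 0`, and layer-`0` control over `ℚ` (`rank X/TX = corank Sel_{p^∞}(E/ℚ)`). [cite: GreenbergLNM1716, Thm 1.2, §3 Lemma 3.1] -/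
theorem selmerCorank_layer_one_le (hgood : W.HasGoodReductionAtPrime p) (hord : ¬ (p : ℤ) ∣ W.frobeniusTrace p)
    (hκ : κ.IsCyclotomic) (hγ : κ.IsTopGenerator γ) (D : W.SelmerDualData κ γ) :
    (W.baseChange (κ.layer 1)).selmerCorank p ≤
      W.selmerCorank p + lambdaInvariant p (D.X ⧸ (Ideal.span {xi p} • ⊤ : Submodule (IwasawaAlgebra p) D.X)) := by
  haveI : Module.Finite (IwasawaAlgebra p) D.X := SelmerDualData.module_finite_of_isCyclotomic W κ hκ D hγ
  have h0 : IwasawaAlgebra.coinvariantsRank p D.X = W.selmerCorank p :=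
    (Greenberg1999_coinvariantsRank_eq_selmerCorank_rat_holds W p hgood hord κ γ hκ hγ D).2
  have h := selmerCorank_layer_succ_le W κ hγ D 0
  rw [lambdaInvariant_layerQuotient_zero_eq_coinvariantsRank W p κ D, h0,
    lambdaInvariant_cyclotomicFactor_zero_eq_xi W p κ D] at h
  exact h

/-- ★★★ **`corank Sel_{p^∞}(E_{ℚ_1}/ℚ_1) = corank Sel_{p^∞}(E/ℚ) + rank_{ℤ_p} X/ξ_pX` as soon as `coker s_1` is finite.**
[cite: GreenbergLNM1716, Thm 1.2 and §1 p. 65] -/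
theorem selmerCorank_layer_one_eq_add_of_finite_cokerS (hgood : W.HasGoodReductionAtPrime p)
    (hord : ¬ (p : ℤ) ∣ W.frobeniusTrace p) (hκ : κ.IsCyclotomic) (hγ : κ.IsTopGenerator γ) (D : W.SelmerDualData κ γ)
    [Finite (W.CokerS κ 1)] :
    (W.baseChange (κ.layer 1)).selmerCorank p =
      W.selmerCorank p + lambdaInvariant p (D.X ⧸ (Ideal.span {xi p} • ⊤ : Submodule (IwasawaAlgebra p) D.X)) := by
  haveI : Module.Finite (IwasawaAlgebra p) D.X := SelmerDualData.module_finite_of_isCyclotomic W κ hκ D hγ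
  have h0 : IwasawaAlgebra.coinvariantsRank p D.X = W.selmerCorank p :=
    (Greenberg1999_coinvariantsRank_eq_selmerCorank_rat_holds W p hgood hord κ γ hκ hγ D).2
  have hs := lambdaInvariant_layerQuotient_succ_eq_add W κ hγ D 0
  rw [zero_add, lambdaInvariant_layerQuotient_zero_eq_coinvariantsRank W p κ D, h0,
    lambdaInvariant_cyclotomicFactor_zero_eq_xi W p κ D] at hs
  have h1 := zpCorank_selmerLayer_eq_lambdaInvariant_layerQuotient_of_finite_cokerS W κ hγ D 1
  rw [pow_one] at h1 hs
  rw [hs] at h1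
  exact (selmerCorank_layer_eq_zpCorank_selmerLayer W κ 1).trans h1

/-- ★★★ **The same as soon as Greenberg's `ker g_1 = A_1/Sel_1` is finite.** [cite: GreenbergLNM1716, §3 Lemma 3.5 (p. 90)] -/
theorem selmerCorank_layer_one_eq_add_of_finite_kerG (hgood : W.HasGoodReductionAtPrime p)
    (hord : ¬ (p : ℤ) ∣ W.frobeniusTrace p) (hκ : κ.IsCyclotomic) (hγ : κ.IsTopGenerator γ) (D : W.SelmerDualData κ γ)
    [Finite (W.KerG κ 1)] :
    (W.baseChange (κ.layer 1)).selmerCorank p =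
      W.selmerCorank p + lambdaInvariant p (D.X ⧸ (Ideal.span {xi p} • ⊤ : Submodule (IwasawaAlgebra p) D.X)) := by
  haveI := finite_cokerS_of_finite_kerG W κ 1
  exact selmerCorank_layer_one_eq_add_of_finite_cokerS W hgood hord hκ hγ D

/-- ★★★ **The same as soon as `𝒦_{v,1}[p^∞] = ker(H¹(ℚ_{1,v}, E) → H¹(ℚ_{∞,η}, E))[p^∞]` is finite at the place `v = p`** — Greenberg's
Lemma 3.4 at the layer `n = 1`, finiteness clause: the ONE input of first-layer corank control over `ℚ` not in the tree
(`…SelmerLayerControlLocal`). [cite: GreenbergLNM1716, §3 Lemmas 3.3–3.5 (pp. 86–90)] -/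
theorem selmerCorank_layer_one_eq_add_of_finite_localTowerKerPrimary_one (hgood : W.HasGoodReductionAtPrime p)
    (hord : ¬ (p : ℤ) ∣ W.frobeniusTrace p) (hκ : κ.IsCyclotomic) (hγ : κ.IsTopGenerator γ) (D : W.SelmerDualData κ γ)
    (hfin : ∀ v : IsDedekindDomain.HeightOneSpectrum (NumberField.RingOfIntegers ℚ),
      (p : NumberField.RingOfIntegers ℚ) ∈ v.asIdeal → Finite (W.localTowerKerPrimary κ (v.adicCompletion ℚ) 1)) :
    (W.baseChange (κ.layer 1)).selmerCorank p =
      W.selmerCorank p + lambdaInvariant p (D.X ⧸ (Ideal.span {xi p} • ⊤ : Submodule (IwasawaAlgebra p) D.X)) := by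
  haveI := finite_kerG_of_finite_localTowerKerPrimary_dvd W κ 1 hfin
  exact selmerCorank_layer_one_eq_add_of_finite_kerG W hgood hord hκ hγ D

/-- ★★★ **The same modulo the named print fact Lemma 3.4 (`F = ℚ`)** (`Greenberg1999.lemma34_natCard_localTowerKerPrimary_eq_rat`, via
`selmer_control_of_lemma34`; displayed hypothesis `h34`). [cite: GreenbergLNM1716, Thm 1.2 and §3 Lemma 3.4 (p. 89)] -/
theorem selmerCorank_layer_one_eq_add_of_lemma34 (h34 : Greenberg1999.lemma34_natCard_localTowerKerPrimary_eq_rat)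
    (hgood : W.HasGoodReductionAtPrime p) (hord : ¬ (p : ℤ) ∣ W.frobeniusTrace p) (hκ : κ.IsCyclotomic) (hγ : κ.IsTopGenerator γ)
    (D : W.SelmerDualData κ γ) :
    (W.baseChange (κ.layer 1)).selmerCorank p =
      W.selmerCorank p + lambdaInvariant p (D.X ⧸ (Ideal.span {xi p} • ⊤ : Submodule (IwasawaAlgebra p) D.X)) := by
  obtain ⟨B, hB⟩ := W.selmer_control_of_lemma34 κ h34 hκ (W.hasGoodReductionAt_and_hasUnitRootAt_of_rat hgood hord)
  haveI : Finite (W.CokerS κ 1) := (hB 1).2.2.1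
  exact selmerCorank_layer_one_eq_add_of_finite_cokerS W hgood hord hκ hγ D

/-- ★★ **`corank Sel_{p^∞}(E/ℚ) < corank Sel_{p^∞}(E_{ℚ_1}/ℚ_1) ⟹ ξ_p ∣ char_Λ X`, UNCONDITIONALLY** (`X` torsion; new points OR new
`Ш[p^∞]`-corank over the first layer force the first cyclotomic zero `ξ_p = Φ_p(1+T)` of `f_X`; `…SelmerLayerGrowthDichotomy` §3
in the `ξ_p` spelling). [cite: GreenbergLNM1716, §5 p. 132, Thm 1.2] -/
theorem xi_dvd_of_mem_charIdeal_of_selmerCorank_lt_layer_one (hgood : W.HasGoodReductionAtPrime p)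
    (hord : ¬ (p : ℤ) ∣ W.frobeniusTrace p) (hκ : κ.IsCyclotomic) (hγ : κ.IsTopGenerator γ) (D : W.SelmerDualData κ γ)
    (hD : D.IsTorsion) (h : W.selmerCorank p < (W.baseChange (κ.layer 1)).selmerCorank p)
    {g : IwasawaAlgebra p} (hg : g ∈ D.charIdeal) : xi p ∣ g := by
  rw [← coe_cyclotomicLayer_zero]
  exact cyclotomicLayer_one_dvd_of_mem_charIdeal_of_selmerCorank_lt_layer_one W hgood hord hκ hγ D hD h hg

/-- Dichotomy form with `char_Λ X = (f)`: **either `corank Sel_{p^∞}(E_{ℚ_1}/ℚ_1) = corank Sel_{p^∞}(E/ℚ)`-bounded (no Selmer growth in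
the first layer) or `ξ_p ∣ f`**, unconditionally. [cite: GreenbergLNM1716, §5 p. 132] -/
theorem selmerCorank_layer_one_le_or_xi_dvd (hgood : W.HasGoodReductionAtPrime p) (hord : ¬ (p : ℤ) ∣ W.frobeniusTrace p)
    (hκ : κ.IsCyclotomic) (hγ : κ.IsTopGenerator γ) (D : W.SelmerDualData κ γ) (hD : D.IsTorsion) {f : IwasawaAlgebra p}
    (hf : D.charIdeal = Ideal.span {f}) :
    (W.baseChange (κ.layer 1)).selmerCorank p ≤ W.selmerCorank p ∨ xi p ∣ f := by
  by_cases h : W.selmerCorank p < (W.baseChange (κ.layer 1)).selmerCorank p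
  · exact Or.inr (xi_dvd_of_mem_charIdeal_of_selmerCorank_lt_layer_one W hgood hord hκ hγ D hD h
      (by rw [hf]; exact Ideal.mem_span_singleton_self f))
  · exact Or.inl (not_lt.mp h)

end RatLayerOne

end Summit.BirchSwinnertonDyer.BirchSwinnertonDyer.Theorems.AlignedTransportAtTwoSelmerLayerOneMatching

end
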